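import Literature.AlgebraicGeometry.Motives.HodgeNumberHarmonicFrames
import Literature.AlgebraicGeometry.Motives.HodgeDecompositionHarmonicRepresentativeProofs
import Literature.Analysis.OperatorTheory.PerturbedSubspaceLimit
import Literature.NumberTheory.Transcendental.KaehlerHodgePreHilbert

/-!
# Route NoetherLefschetzOneUp — `GenericGeometricGenus`: the harmonic limit lemma (u.s.c. of Hodge numbers, step 1)

Helper for item stmt-HodgeConjecture-15374, whose missing input is the upper semicontinuity of the
Hodge numbers of the fibres of a smooth projective family (Voisin I Cor. 9.19; Kodaira Thm. 7.3).
On ONE compact Kähler manifold `(M, g, o)` (the central fibre), in `V = A^k(M; ℂ)` with the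
Hermitian `L²` product (`CL2SmoothForms o k`): the type projection `α ↦ α^{p,q}` is the orthogonal
projection onto `typeFixed o k p q` (bidegrees are `L²`-orthogonal, Huybrechts Prop. 3.2.2 (ii));
the harmonic forms `harmonicSubspace o h` are finite-dimensional and orthogonal to the exact forms
`exactSubspace o k`, and closed forms lie in their sum (Voisin I Thm. 5.23); whence, by the tree's
abstract lemma `exists_linearIndependent_of_subspaces` (`PerturbedSubspaceLimit`), the HARMONIC
LIMIT LEMMA `le_finrank_hodgePQ_of_perturbedSubspaces`: subspaces `W_i ≤ V` of closed forms with
forms `B_i` killing `(exact, W_i)` and `ε_i`-close to `( , )_{L²}` there, maps `L_i` fixing `W_i`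
and `η_i`-close to the type projection, `ε_i, η_i → 0`, each containing `N` independent vectors,
force `N ≤ h^{p,q}(M) = dim hodgePQ E M k p q`. In the semicontinuity proof `W_i` are the harmonic
`(p,q)`-forms of the fibre `X_{s_i}` transported to `M = X_{s₀}` (steps 2–3: transport, convergence).
-/


set_option linter.dupNamespace false

noncomputable section

open scoped Manifold ContDiff Topology ComplexInnerProductSpace
open Bundle Module Set Finset Filter
open Literature.Geometry.Kaehler Literature.NumberTheory.Transcendental
open Literature.AlgebraicGeometry.Motives Literature.Analysis.OperatorTheory

namespace Summit.HodgeConjecture.HodgeConjecture.Theorems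

variable {E : Type*} [NormedAddCommGroup E] [NormedSpace ℂ E] [FiniteDimensional ℂ E]
  {n : ℕ} [Fact (finrank ℝ E = n)] [MeasurableSpace E] [BorelSpace E]
  {M : Type*} [TopologicalSpace M] [ChartedSpace E M] [IsManifold 𝓘(ℝ, E) ∞ M]
  [T2Space M] [CompactSpace M]

/-! ### Bidegrees are orthogonal; the type projection is an orthogonal projection -/

section TypeProjection

variable [RiemannianBundle (fun x : M ↦ TangentSpace 𝓘(ℝ, E) x)]
  [IsContMDiffRiemannianBundle 𝓘(ℝ, E) ∞ E (fun x : M ↦ TangentSpace 𝓘(ℝ, E) x)]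
  (o : (x : M) → Orientation ℝ (TangentSpace 𝓘(ℝ, E) x) (Fin n))
  [Fact (IsSmoothForm (riemannianVolumeForm o))] (k : ℕ)

omit [FiniteDimensional ℂ E] [Fact (finrank ℝ E = n)] [MeasurableSpace E] [BorelSpace E]
  [IsManifold 𝓘(ℝ, E) ∞ M] [T2Space M] [CompactSpace M]
  [RiemannianBundle (fun x : M ↦ TangentSpace 𝓘(ℝ, E) x)]
  [IsContMDiffRiemannianBundle 𝓘(ℝ, E) ∞ E (fun x : M ↦ TangentSpace 𝓘(ℝ, E) x)]
  [Fact (IsSmoothForm (riemannianVolumeForm o))] in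
/-- `toForm : A^k(M; ℂ) → Ω^k_ℂ(M)` is injective (a type synonym of a submodule). [folklore] -/
theorem toForm_injective : Function.Injective (CL2SmoothForms.toForm o (k := k)) :=
  fun _ _ hab ↦ Subtype.ext hab

/-- **Bidegrees are `L²`-orthogonal** (Huybrechts (2005), Prop. 3.2.2 (ii)): for a Hermitian
metric, smooth forms of types `(p,q) ≠ (p',q')` in the same degree are orthogonal in `A^k(M; ℂ)`
(`MForm.cl2Inner_eq_zero_of_weight_ne`: the weights `p - q ≠ p' - q'`).
[cite: Huybrechts2005, Prop. 3.2.2 (ii)] -/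
theorem inner_eq_zero_of_isOfType_of_ne
    (hH : ∀ (x : M) (v w : TangentSpace 𝓘(ℝ, E) x), inner ℝ (tangentJ E x v) (tangentJ E x w) = inner ℝ v w)
    {m : ℕ} (hk : k + m = n) {p q p' q' : ℕ} (hne : (p, q) ≠ (p', q'))
    {a b : CL2SmoothForms o k} (ha : IsOfType p q (CL2SmoothForms.toForm o a))
    (hb : IsOfType p' q' (CL2SmoothForms.toForm o b)) : inner ℂ a b = 0 := by
  haveI : IsContinuousRiemannianBundle E (fun x : M ↦ TangentSpace 𝓘(ℝ, E) x) :=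
    isContinuousRiemannianBundle_of_isContMDiffRiemannianBundle
  have hw : ((p : ℤ) - q : ℤ) ≠ ((p' : ℤ) - q' : ℤ) := by
    intro h
    have h1 := ha.add_eq
    have h2 := hb.add_eq
    apply hne
    have : p = p' := by omega
    subst this
    have : q = q' := by omega
    subst this
    rfl
  rw [CL2SmoothForms.inner_def]
  refine MForm.cl2Inner_eq_zero_of_weight_ne o hH Fact.out hk hw
    (CL2SmoothForms.isSmoothForm_toForm o a) (CL2SmoothForms.isSmoothForm_toForm o b)
    (fun x θ v ↦ ?_) (fun x θ v ↦ ?_)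
  · simpa [Function.comp_def] using ha.2 x θ v
  · simpa [Function.comp_def] using hb.2 x θ v

variable [IsManifold 𝓘(ℂ, E) ω M]

/-- **`v - v^{p,q}` is orthogonal to the forms of type `(p,q)`** (Hermitian metric, holomorphic
atlas): `v - v^{p,q}` is the sum of the other type components (`sum_antidiagonal_typeComponent_holds`),
each of pure type (`isOfType_typeComponent_holds`) and orthogonal to type `(p,q)`
(`inner_eq_zero_of_isOfType_of_ne`). Here `v^{p,q} ∈ A^k(M; ℂ)` by `IsSmoothForm.typeComponent`.
[cite: Huybrechts2005, Prop. 3.2.2 (ii)] -/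
theorem inner_sub_typeComponent_eq_zero
    (hH : ∀ (x : M) (v w : TangentSpace 𝓘(ℝ, E) x), inner ℝ (tangentJ E x v) (tangentJ E x w) = inner ℝ v w)
    {m : ℕ} (hk : k + m = n) {p q : ℕ} (v t : CL2SmoothForms o k)
    (ht : IsOfType p q (CL2SmoothForms.toForm o t)) :
    inner ℂ (v - CL2SmoothForms.mk o ((CL2SmoothForms.toForm o v).typeComponent p q)
      ((CL2SmoothForms.isSmoothForm_toForm o v).typeComponent p q)) t = 0 := by
  classical
  have hpq : p + q = k := ht.add_eq
  -- the type components of `v` inside `A^k(M; ℂ)`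
  let P : ℕ × ℕ → CL2SmoothForms o k := fun pq ↦
    CL2SmoothForms.mk o ((CL2SmoothForms.toForm o v).typeComponent pq.1 pq.2)
      ((CL2SmoothForms.isSmoothForm_toForm o v).typeComponent pq.1 pq.2)
  -- `v - v^{p,q} = ∑_{(p',q') ≠ (p,q)} v^{p',q'}`
  have hsum : v - P (p, q) = ∑ pq ∈ (antidiagonal k).erase (p, q), P pq := by
    have hall : ∑ pq ∈ antidiagonal k, P pq = v := by
      apply toForm_injective o k
      rw [← CL2SmoothForms.toFormₗ_apply, map_sum]
      exact sum_antidiagonal_typeComponent_holds (CL2SmoothForms.toForm o v)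
    have hmem : (p, q) ∈ antidiagonal k := by simpa using hpq
    rw [← Finset.add_sum_erase _ _ hmem] at hall
    exact sub_eq_of_eq_add' hall.symm
  change inner ℂ (v - P (p, q)) t = 0
  rw [hsum, sum_inner]
  refine Finset.sum_eq_zero fun pq hpq' ↦ ?_
  have hne : (pq.1, pq.2) ≠ (p, q) := by
    intro h; rw [Finset.mem_erase] at hpq'; exact hpq'.1 (by rw [← h])
  have hk' : pq.1 + pq.2 = k := by
    rw [Finset.mem_erase, mem_antidiagonal] at hpq'; exact hpq'.2
  exact inner_eq_zero_of_isOfType_of_ne o k hH hk hne (isOfType_typeComponent_holds hk' _) ht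

end TypeProjection

/-! ### The harmonic limit lemma -/

section Limit

variable [RiemannianBundle (fun x : M ↦ TangentSpace 𝓘(ℝ, E) x)]
  [IsContMDiffRiemannianBundle 𝓘(ℝ, E) ∞ E (fun x : M ↦ TangentSpace 𝓘(ℝ, E) x)]
  (o : (x : M) → Orientation ℝ (TangentSpace 𝓘(ℝ, E) x) (Fin n))
  [Fact (IsSmoothForm (riemannianVolumeForm o))] {k m : ℕ} (h : k + m = n)
  [IsManifold 𝓘(ℂ, E) ω M]

/-- **The harmonic limit lemma, frame form** (generic smooth metric, Hermitian `hH`, with harmonic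
representatives in degree `k`, `h11` — Warner Thm. 6.11, a theorem at a Kähler metric). Let
`V = A^k(M; ℂ)` with its Hermitian `L²` product, and for `i ∈ ℕ` let `W_i ≤ V` be subspaces of
CLOSED forms, `B_i : V → V → ℂ` forms and `L_i : V → V` maps with: `B_i(d, w) = 0` and
`‖B_i(d, w) - ⟪d, w⟫‖ ≤ ε_i (‖d‖² + ‖w‖²)` for `w ∈ W_i`, `d` exact; `L_i w = w` and
`‖L_i w - w^{p,q}‖ ≤ η_i ‖w‖` for `w ∈ W_i`; `ε_i, η_i → 0`; and `N` independent vectors in every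
`W_i`. Then there are `N` linearly independent `Δ_d`-harmonic forms equal to their
`(p,q)`-components. Proof: the tree's abstract lemma `exists_linearIndependent_of_subspaces`
(`PerturbedSubspaceLimit`) with `H` = the harmonic forms — finite-dimensional, injecting into
`H^k_dR(M; ℂ)` (an exact harmonic form vanishes) — `D` = the exact forms, `H ⊥ D`
(`cl2Inner_eq_zero_of_isCHarmonicForm_of_mem_cexactSmoothForms`), closed forms in `H ⊔ D`
(`exists_isCHarmonicForm_mk_eq`, Voisin I Thm. 5.23), and `L` = the orthogonal projection onto the
subspace of forms equal to their `(p,q)`-component, which is the type projection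
(`inner_sub_typeComponent_eq_zero`). [cite: VoisinHodgeI2002, §9.3.1 Cor. 9.19] [cite: Kodaira2005, Thm. 7.3] -/
theorem exists_harmonic_frame_of_perturbedSubspaces
    (hH : ∀ (x : M) (v w : TangentSpace 𝓘(ℝ, E) x), inner ℝ (tangentJ E x v) (tangentJ E x w) = inner ℝ v w)
    (h11 : existsUnique_isHarmonicForm_mk_eq_of_compact 𝓘(ℝ, E) M o k m) (p q : ℕ)
    (W : ℕ → Submodule ℂ (CL2SmoothForms o k)) (B : ℕ → CL2SmoothForms o k → CL2SmoothForms o k → ℂ)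
    (Lᵢ : ℕ → CL2SmoothForms o k → CL2SmoothForms o k) (ε η : ℕ → ℝ)
    (hε : Tendsto ε atTop (𝓝 0)) (hη : Tendsto η atTop (𝓝 0))
    (hWc : ∀ i, ∀ w ∈ W i, CL2SmoothForms.toForm o w ∈ cclosedSmoothForms E M k)
    (hB0 : ∀ i, ∀ w ∈ W i, ∀ d : CL2SmoothForms o k,
      CL2SmoothForms.toForm o d ∈ cexactSmoothForms E M k → B i d w = 0)
    (hBε : ∀ i, ∀ w ∈ W i, ∀ d : CL2SmoothForms o k,
      CL2SmoothForms.toForm o d ∈ cexactSmoothForms E M k →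
        ‖B i d w - inner ℂ d w‖ ≤ ε i * (‖d‖ ^ 2 + ‖w‖ ^ 2))
    (hLfix : ∀ i, ∀ w ∈ W i, Lᵢ i w = w)
    (hLη : ∀ i, ∀ w ∈ W i, ‖Lᵢ i w - CL2SmoothForms.mk o ((CL2SmoothForms.toForm o w).typeComponent p q)
      ((CL2SmoothForms.isSmoothForm_toForm o w).typeComponent p q)‖ ≤ η i * ‖w‖)
    {N : ℕ} (hN : ∀ i, ∃ f : Fin N → CL2SmoothForms o k, LinearIndependent ℂ f ∧ ∀ j, f j ∈ W i) :
    ∃ u : Fin N → MForm 𝓘(ℝ, E) M ℂ k, LinearIndependent ℂ u ∧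
      ∀ j, IsCHarmonicForm o h (u j) ∧ (u j).typeComponent p q = u j := by
  have ho : IsSmoothForm (riemannianVolumeForm o) := Fact.out
  -- the type projection `P`, the orthogonal projection onto `T = {v | v^{p,q} = v}`
  let P : CL2SmoothForms o k → CL2SmoothForms o k := fun v ↦
    CL2SmoothForms.mk o ((CL2SmoothForms.toForm o v).typeComponent p q)
      ((CL2SmoothForms.isSmoothForm_toForm o v).typeComponent p q)
  let T : Submodule ℂ (CL2SmoothForms o k) :=
    { carrier := {v | (CL2SmoothForms.toForm o v).typeComponent p q = CL2SmoothForms.toForm o v}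
      zero_mem' := by
        change (CL2SmoothForms.toForm o (0 : CL2SmoothForms o k)).typeComponent p q = _
        rw [CL2SmoothForms.toForm_zero, MForm.typeComponent_zero]
      add_mem' := fun {a b} ha hb ↦ by
        change (CL2SmoothForms.toForm o (a + b)).typeComponent p q = _
        rw [CL2SmoothForms.toForm_add, MForm.typeComponent_add, ha, hb]
      smul_mem' := fun c {a} ha ↦ by
        change (CL2SmoothForms.toForm o (c • a)).typeComponent p q = _
        rw [CL2SmoothForms.toForm_smul, MForm.typeComponent_smul, ha] }
  have hPT : ∀ v, P v ∈ T := fun v ↦ typeComponent_typeComponent_self_holds p q _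
  have hPorth : ∀ v, ∀ t ∈ T, inner ℂ (v - P v) t = 0 := by
    intro v t ht
    by_cases hpq : p + q = k
    · exact inner_sub_typeComponent_eq_zero o k hH h v t
        ((isOfType_iff_typeComponent_eq_self_holds hpq _).2 ht)
    · have ht0 : t = 0 := toForm_injective o k (by
        rw [CL2SmoothForms.toForm_zero, ← ht, MForm.typeComponent_of_ne hpq])
      rw [ht0, inner_zero_right]
  haveI : T.HasOrthogonalProjection :=
    ⟨fun v ↦ ⟨P v, hPT v, (Submodule.mem_orthogonal _ _).2 fun t ht ↦ by
      rw [inner_eq_zero_symm]; exact hPorth v t ht⟩⟩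
  have hL : ∀ v, T.starProjection v = P v := fun v ↦
    Submodule.eq_starProjection_of_mem_of_inner_eq_zero (hPT v) (hPorth v)
  -- harmonic forms `H` (finite-dimensional) and exact forms `D`
  let H : Submodule ℂ (CL2SmoothForms o k) :=
    { carrier := {v | IsCHarmonicForm o h (CL2SmoothForms.toForm o v)}
      zero_mem' := by
        change IsCHarmonicForm o h (CL2SmoothForms.toForm o (0 : CL2SmoothForms o k))
        rw [CL2SmoothForms.toForm_zero]
        exact isCHarmonicForm_zero o h
      add_mem' := fun {a b} ha hb ↦ by
        change IsCHarmonicForm o h (CL2SmoothForms.toForm o (a + b))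
        rw [CL2SmoothForms.toForm_add]
        exact ha.add o ho h hb
      smul_mem' := fun c {a} ha ↦ by
        change IsCHarmonicForm o h (CL2SmoothForms.toForm o (c • a))
        rw [CL2SmoothForms.toForm_smul]
        exact ha.smul o h c }
  let D : Submodule ℂ (CL2SmoothForms o k) := (cexactSmoothForms E M k).comap (CL2SmoothForms.toFormₗ o)
  -- `H` injects into `H^k_dR(M; ℂ)`: harmonic forms are closed, exact harmonic forms vanish
  let toClosed : ↥H →ₗ[ℂ] ↥(cclosedSmoothForms E M k) :=
    { toFun := fun v ↦ ⟨CL2SmoothForms.toForm o (v : CL2SmoothForms o k),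
        mem_cclosedSmoothForms (CL2SmoothForms.isSmoothForm_toForm o _)
          (mextDeriv_eq_zero_of_isCHarmonicForm o ho h v.2)⟩
      map_add' := fun _ _ ↦ rfl
      map_smul' := fun _ _ ↦ rfl }
  haveI : FiniteDimensional ℂ ↥H := by
    haveI : Module.Finite ℂ (complexDeRhamCohomology E M k) :=
      complexDeRhamCohomology.finite_of_compactSpace E M k
    refine Module.Finite.of_injective ((complexDeRhamCohomology.mk E M k).comp toClosed) ?_
    rw [← LinearMap.ker_eq_bot, LinearMap.ker_eq_bot']
    intro v hv
    have hv' : complexDeRhamCohomology.mk E M k (toClosed v) = complexDeRhamCohomology.mk E M k 0 := by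
      rw [map_zero]; exact hv
    have hex : CL2SmoothForms.toForm o (v : CL2SmoothForms o k) ∈ cexactSmoothForms E M k := by
      simpa [toClosed] using (complexDeRhamCohomology.mk_eq_mk_iff _ 0).1 hv'
    exact Subtype.ext (toForm_injective o k (by
      simpa using eq_zero_of_isCHarmonicForm_of_mem_cexactSmoothForms o ho h v.2 hex))
  -- `H ⊥ D`, and closed forms lie in `H ⊔ D` (harmonic representatives)
  have hHD : ∀ a ∈ H, ∀ d ∈ D, inner ℂ a d = 0 := fun a ha d hd ↦ by
    rw [CL2SmoothForms.inner_def]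
    exact cl2Inner_eq_zero_of_isCHarmonicForm_of_mem_cexactSmoothForms o ho h ha hd
  have hW : ∀ i, W i ≤ H ⊔ D := by
    intro i v hv
    obtain ⟨γ, hγ, hγc⟩ := exists_isCHarmonicForm_mk_eq o h11 ho h
      (complexDeRhamCohomology.mk E M k ⟨CL2SmoothForms.toForm o v, hWc i v hv⟩)
    let a : CL2SmoothForms o k := CL2SmoothForms.mk o (γ : MForm 𝓘(ℝ, E) M ℂ k) hγ.1
    have ha : a ∈ H := hγ
    have hd : v - a ∈ D := by
      change CL2SmoothForms.toForm o (v - a) ∈ cexactSmoothForms E M k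
      rw [CL2SmoothForms.toForm_sub]
      exact (complexDeRhamCohomology.mk_eq_mk_iff ⟨CL2SmoothForms.toForm o v, hWc i v hv⟩ γ).1 hγc.symm
    have : v = a + (v - a) := by abel
    rw [this]
    exact Submodule.add_mem_sup ha hd
  -- the abstract limit lemma
  obtain ⟨f, hf, hfH⟩ := exists_linearIndependent_of_subspaces H D hHD T.starProjection W B Lᵢ ε η
    hε hη hW (fun i w hw d hd ↦ hB0 i w hw d hd) (fun i w hw d hd ↦ hBε i w hw d hd) hLfix
    (fun i w hw ↦ by rw [hL]; exact hLη i w hw) hN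
  refine ⟨fun j ↦ CL2SmoothForms.toForm o (f j), ?_, fun j ↦ ⟨(hfH j).1, ?_⟩⟩
  · exact hf.map' (CL2SmoothForms.toFormₗ o)
      (LinearMap.ker_eq_bot.2 fun a b hab ↦ toForm_injective o k hab)
  · have hmem : f j ∈ T := by rw [← Submodule.starProjection_eq_self_iff]; exact (hfH j).2
    exact hmem

end Limit

/-! ### At a Kähler metric: the harmonic limit lemma -/

section Kaehler

variable [IsManifold 𝓘(ℂ, E) ω M] (g : ContMDiffRiemannianMetric 𝓘(ℝ, E) ∞ E (fun x : M ↦ TangentSpace 𝓘(ℝ, E) x))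
  (o : (x : M) → Orientation ℝ (TangentSpace 𝓘(ℝ, E) x) (Fin n))

/-- **The harmonic limit lemma (upper semicontinuity of Hodge numbers, step 1).** Let `(M, g, o)`
be a compact Kähler manifold (holomorphic atlas, smooth Kähler metric, orientation family with
smooth volume form), `k + m = dim_ℝ M`, `(p,q)` a type, and `V = A^k(M; ℂ)` with the Hermitian `L²`
product. Suppose given, for `i ∈ ℕ`, subspaces `W_i ≤ V` of CLOSED forms, forms
`B_i : V → V → ℂ` and maps `L_i : V → V` with: `B_i(d, w) = 0` and
`‖B_i(d, w) - ⟪d, w⟫‖ ≤ ε_i (‖d‖² + ‖w‖²)` for `w ∈ W_i`, `d` exact; `L_i w = w` and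
`‖L_i w - w^{p,q}‖ ≤ η_i ‖w‖` for `w ∈ W_i`; `ε_i, η_i → 0`; and `N` independent vectors in every
`W_i`. Then `N ≤ h^{p,q}(M) = dim_ℂ K^{p,q}` (`hodgePQ E M k p q`). Proof: harmonic forms `H`
(finite-dimensional) are orthogonal to exact forms `D`, closed forms lie in `H ⊔ D` (Thm. 5.23 at
the Kähler metric), and the type projection is the orthogonal projection onto `typeFixed`
(bidegrees are orthogonal, the metric being Hermitian), so `exists_linearIndependent_of_subspaces`
gives `N` independent harmonic forms fixed by the type projection, i.e. harmonic `(p,q)`-forms, and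
`le_finrank_hodgePQ_of_linearIndependent` (`Motives/HodgeNumberHarmonicFrames`) applies. This is
the abstract form of Voisin I Cor. 9.19 / Kodaira Thm. 7.3 as used for Kähler fibres.
[cite: VoisinHodgeI2002, §9.3.1 Thm. 9.15 and Cor. 9.19] [cite: Kodaira2005, Thm. 7.3] -/
theorem le_finrank_hodgePQ_of_perturbedSubspaces (hg : g.toRiemannianMetric.IsKaehler) {k m : ℕ}
    (h : k + m = n) (p q : ℕ) :
    letI : RiemannianBundle (fun x : M ↦ TangentSpace 𝓘(ℝ, E) x) := ⟨g.toRiemannianMetric⟩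
    ∀ [Fact (IsSmoothForm (riemannianVolumeForm o))]
      (W : ℕ → Submodule ℂ (CL2SmoothForms o k)) (B : ℕ → CL2SmoothForms o k → CL2SmoothForms o k → ℂ)
      (Lᵢ : ℕ → CL2SmoothForms o k → CL2SmoothForms o k) (ε η : ℕ → ℝ),
      Tendsto ε atTop (𝓝 0) → Tendsto η atTop (𝓝 0) →
      (∀ i, ∀ w ∈ W i, CL2SmoothForms.toForm o w ∈ cclosedSmoothForms E M k) →
      (∀ i, ∀ w ∈ W i, ∀ d : CL2SmoothForms o k,
        CL2SmoothForms.toForm o d ∈ cexactSmoothForms E M k → B i d w = 0) →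
      (∀ i, ∀ w ∈ W i, ∀ d : CL2SmoothForms o k,
        CL2SmoothForms.toForm o d ∈ cexactSmoothForms E M k →
          ‖B i d w - inner ℂ d w‖ ≤ ε i * (‖d‖ ^ 2 + ‖w‖ ^ 2)) →
      (∀ i, ∀ w ∈ W i, Lᵢ i w = w) →
      (haveI : IsContMDiffRiemannianBundle 𝓘(ℝ, E) ∞ E (fun x : M ↦ TangentSpace 𝓘(ℝ, E) x) :=
          ⟨g.inner, g.contMDiff, fun _ _ _ ↦ rfl⟩
        ∀ i, ∀ w ∈ W i, ‖Lᵢ i w - CL2SmoothForms.mk o ((CL2SmoothForms.toForm o w).typeComponent p q)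
          ((CL2SmoothForms.isSmoothForm_toForm o w).typeComponent p q)‖ ≤ η i * ‖w‖) →
      ∀ {N : ℕ}, (∀ i, ∃ f : Fin N → CL2SmoothForms o k, LinearIndependent ℂ f ∧ ∀ j, f j ∈ W i) →
        N ≤ finrank ℂ ↥(hodgePQ E M k p q) := by
  letI : RiemannianBundle (fun x : M ↦ TangentSpace 𝓘(ℝ, E) x) := ⟨g.toRiemannianMetric⟩
  haveI : IsContMDiffRiemannianBundle 𝓘(ℝ, E) ∞ E (fun x : M ↦ TangentSpace 𝓘(ℝ, E) x) :=
    ⟨g.inner, g.contMDiff, fun _ _ _ ↦ rfl⟩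
  intro _ W B Lᵢ ε η hε hη hWc hB0 hBε hLfix hLη N hN
  have ho : IsSmoothForm (riemannianVolumeForm o) := Fact.out
  have hH : ∀ (x : M) (v w : TangentSpace 𝓘(ℝ, E) x),
      inner ℝ (tangentJ E x v) (tangentJ E x w) = inner ℝ v w := fun x v w ↦ hg.isHermitian x v w
  have h11 := existsUnique_isHarmonicForm_mk_eq_of_compact_of_isKaehler g o hg k m
  obtain ⟨u, hu, hut⟩ := exists_harmonic_frame_of_perturbedSubspaces o h hH h11 p q W B Lᵢ ε η
    hε hη hWc hB0 hBε hLfix hLη hN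
  by_cases hpq : p + q = k
  · exact le_finrank_hodgePQ_of_linearIndependent g o h u hu
      (fun j ↦ (isOfType_iff_typeComponent_eq_self_holds hpq _).2 (hut j).2) ho
      (fun j ↦ (hut j).1)
  · -- off the antidiagonal the frame is `0`, so `N = 0`
    cases N with
    | zero => exact Nat.zero_le _
    | succ N =>
      exfalso
      have h0 : u 0 = 0 := by
        rw [← (hut 0).2, MForm.typeComponent_of_ne hpq]
      exact hu.ne_zero 0 h0

end Kaehler

end Summit.HodgeConjecture.HodgeConjecture.Theorems

end
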